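import Summits.HodgeConjecture.HodgeConjecture.Theorems.NikulinTwinTransportTwinTwistorTransportStubCommutant

/-!
# Route NikulinTwinTransport · crux `TwinTwistorTransport` (stmt-HodgeConjecture-14393) —
# stub `stub_homBlock` of line `Sketch` (idea `ordinary-prime-anchors`, step (A1))

Pure linear algebra (Mathlib + the landed `stub_commutant`): let `F : Module.End L T` have
IRREDUCIBLE characteristic polynomial (`T` finite-dimensional over the field `L`), and let the
linear equivalence `Ψ : T'' ≃ₗ[L] T` intertwine `F'' : Module.End L T''` with `F`
(`Ψ ∘ F'' = F ∘ Ψ`). Then every intertwiner `φ : T'' →ₗ[L] T` (`φ ∘ F'' = F ∘ φ`) is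
`p(F) ∘ Ψ` for some polynomial `p : L[X]`; i.e. the Hom block `Hom_F(T'', T)` is free of rank one
over the field `L[F] ≅ L[X]/(χ_F)`, generated by `Ψ`.

Proof. `ψ := φ ∘ Ψ⁻¹ : Module.End L T` commutes with `F` (as `Ψ⁻¹ ∘ F = F'' ∘ Ψ⁻¹`), so by
`stub_commutant` it is `p(F)`; composing with `Ψ` gives `φ = p(F) ∘ Ψ`.

This is the dimension count of step (A1) of the card `ordinary-prime-anchors` (every Tate class of
the block `Hom_F(T_ℓ(S₀''), T_ℓ(S₀))` of a twin pair of ordinary K3 surfaces is `p(F) ∘ u`); it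
supports the load-bearing stub `stub_twinTransport` of the skeleton
`Cruxes/TwinTwistorTransport/Lines/Sketch.lean`.
-/

open Polynomial

namespace Summit.HodgeConjecture.HodgeConjecture.Theorems.NikulinTwinTransport

/-- rank-one Hom block — every intertwiner of F'' with F is p(F) ∘ Ψ; step (A1) of idea
ordinary-prime-anchors for crux TwinTwistorTransport; [folklore].
Pointwise form of the inverse intertwining relation: if `Ψ ∘ F'' = F ∘ Ψ` for a linear
equivalence `Ψ`, then `Ψ⁻¹ (F y) = F'' (Ψ⁻¹ y)` for every `y`. -/
theorem symm_apply_intertwine {L : Type*} [Field L] {T : Type*} [AddCommGroup T] [Module L T]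
    {T'' : Type*} [AddCommGroup T''] [Module L T''] {F : Module.End L T} {F'' : Module.End L T''}
    (Ψ : T'' ≃ₗ[L] T) (hΨ : Ψ.toLinearMap ∘ₗ F'' = F ∘ₗ Ψ.toLinearMap) (y : T) :
    Ψ.symm (F y) = F'' (Ψ.symm y) := by
  apply Ψ.injective
  have h : Ψ (F'' (Ψ.symm y)) = F (Ψ (Ψ.symm y)) := LinearMap.congr_fun hΨ (Ψ.symm y)
  rw [Ψ.apply_symm_apply, h, Ψ.apply_symm_apply]

/-- rank-one Hom block — every intertwiner of F'' with F is p(F) ∘ Ψ; step (A1) of idea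
ordinary-prime-anchors for crux TwinTwistorTransport; [folklore].
If the characteristic polynomial of `F : Module.End L T` (`T` finite-dimensional over the field
`L`) is irreducible and the linear equivalence `Ψ : T'' ≃ₗ[L] T` intertwines `F''` with `F`, then
every `φ : T'' →ₗ[L] T` intertwining `F''` with `F` is `p(F) ∘ Ψ` for some `p : L[X]`
(apply `stub_commutant` to `φ ∘ Ψ⁻¹`, which commutes with `F`). -/
theorem stub_homBlock : ∀ (L : Type) [Field L] (T : Type) [AddCommGroup T] [Module L T] [FiniteDimensional L T] (T'' : Type) [AddCommGroup T''] [Module L T''] [FiniteDimensional L T''] (F : Module.End L T) (F'' : Module.End L T''), Irreducible F.charpoly → ∀ (Ψ : T'' ≃ₗ[L] T), Ψ.toLinearMap ∘ₗ F'' = F ∘ₗ Ψ.toLinearMap → ∀ (φ : T'' →ₗ[L] T), φ ∘ₗ F'' = F ∘ₗ φ → ∃ p : L[X], φ = (aeval F p).comp Ψ.toLinearMap := by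
  intro L _ T _ _ _ T'' _ _ _ F F'' hirr Ψ hΨ φ hφ
  -- `ψ := φ ∘ Ψ⁻¹` is an endomorphism of `T` commuting with `F`.
  have hφ' : ∀ x : T'', φ (F'' x) = F (φ x) := fun x => LinearMap.congr_fun hφ x
  have hψ : (φ ∘ₗ Ψ.symm.toLinearMap) ∘ₗ F = F ∘ₗ (φ ∘ₗ Ψ.symm.toLinearMap) := by
    refine LinearMap.ext fun y => ?_
    simp only [LinearMap.comp_apply, LinearEquiv.coe_coe]
    rw [symm_apply_intertwine Ψ hΨ y, hφ']
  -- Hence `ψ = p(F)` by the commutant lemma, and `φ = ψ ∘ Ψ = p(F) ∘ Ψ`.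
  obtain ⟨p, hp⟩ := stub_commutant L T F hirr (φ ∘ₗ Ψ.symm.toLinearMap) hψ
  refine ⟨p, LinearMap.ext fun x => ?_⟩
  have hx : (φ ∘ₗ Ψ.symm.toLinearMap) (Ψ x) = aeval F p (Ψ x) := LinearMap.congr_fun hp (Ψ x)
  rw [LinearMap.comp_apply, LinearEquiv.coe_coe, Ψ.symm_apply_apply] at hx
  rw [LinearMap.comp_apply, LinearEquiv.coe_coe, ← hx]

end Summit.HodgeConjecture.HodgeConjecture.Theorems.NikulinTwinTransport
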